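import Mathlib.MeasureTheory.Integral.Lebesgue.Markov
import Mathlib.MeasureTheory.Integral.Lebesgue.Add
import Mathlib.Dynamics.Ergodic.MeasurePreserving
import Literature.Analysis.FluidPDE.SawtoothCascade
import HarnessLib
import Summits.AnomalousDissipation.AnomalousDissipation.Theses.SawtoothPulseCascade

/-!
# K1loc — helper: THE ZONE-VISIT MARKOV BOUND (charging the rounded zones once, Lagrangianly)

Helper file of the first prover lane on the crux `K1LocalisedCascade` (stmt-AnomalousDissipation-19491), route
`SawtoothPulseCascade` (architecture memo `K1loc-architecture-findings-k1locp1.md`, finding F-c, evidence on the item).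
The rounded corner zones `Z_j` of the cascade have summable measures `η_j` but `∑_j √(2η_j) > 1` at the route's `d = 2`, so
zone passages cannot be charged phase by phase; they must be charged ONCE, through the set of points whose orbit visits
zones at least `n` times.  For measure-preserving maps this needs no decorrelation of the visits, only Markov:

* `lintegral_visits_eq` — for a finite family of measure-preserving maps `Φ i` and measurable sets `Z i`, the visit counter
  `N(x) = ∑_{i∈s} 1_{Z i}(Φ i x)` has `∫⁻ N dμ = ∑_{i∈s} μ(Z i)`;
* `mul_meas_visits_ge_le` — **`n · μ{x : n ≤ N(x)} ≤ ∑_{i∈s} μ(Z i)`** for every `n : ℝ≥0∞`;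
* `meas_visits_ge_le_div` — the same as `μ{N ≥ n} ≤ (∑ μ(Z i)) / n` (`n ≠ 0`, `n ≠ ∞`).

In the cascade: `Φ i` = the (volume-preserving) flow map of the smooth divergence-free field `CascadeParams.field` from the
restart phase to phase `i` (`CascadeFieldSmooth`), `Z i` = the preimage-free corner zones of phase `i`; with TEST H's
`∑ η_j ≈ 0.33` at `(γ,ρN) = (5,2)` the thrice-visiting set has measure `≤ 0.11`.  WHAT THIS IS NOT: no statement about
what a zone visit costs (cone ejection, memo F-d) — that is the open Lagrangian heart of the line.
[cite: ElgindiLissMattingly2025, §1.2.3 (exceptional sets of the piecewise-affine dynamics)] [problem: turb]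
-/

-- `Summit.<Summit>.<Problem>`: single-conjunct summit, the duplicate namespace segment is deliberate.
set_option linter.dupNamespace false

noncomputable section

namespace Summit.AnomalousDissipation.AnomalousDissipation.Theorems.SawtoothPulseCascade.K1Zone

open MeasureTheory Set
open scoped ENNReal

variable {X : Type*} [MeasurableSpace X] {μ : Measure X} {ι : Type*}

omit [MeasurableSpace X] in
/-- The visit indicator `x ↦ 1_{Z}(Φ x)` is the indicator of the preimage. [folklore] -/
theorem indicator_comp_eq_indicator_preimage (Φ : X → X) (Z : Set X) :
    (fun x => Z.indicator (1 : X → ℝ≥0∞) (Φ x)) = (Φ ⁻¹' Z).indicator 1 := by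
  funext x
  by_cases hx : Φ x ∈ Z
  · rw [Set.indicator_of_mem hx, Set.indicator_of_mem (show x ∈ Φ ⁻¹' Z from hx)]; rfl
  · rw [Set.indicator_of_notMem hx, Set.indicator_of_notMem (show x ∉ Φ ⁻¹' Z from hx)]

/-- The visit indicator of a measurable set under a measurable map is measurable. [folklore] -/
theorem measurable_indicator_comp {Φ : X → X} (hΦ : Measurable Φ) {Z : Set X} (hZ : MeasurableSet Z) :
    Measurable fun x => Z.indicator (1 : X → ℝ≥0∞) (Φ x) := by
  rw [indicator_comp_eq_indicator_preimage]
  exact measurable_one.indicator (hΦ hZ)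

/-- **Expected number of visits**: `∫⁻ ∑_{i∈s} 1_{Z i}(Φ i x) dμ = ∑_{i∈s} μ(Z i)` for measure-preserving `Φ i`.
[folklore] -/
theorem lintegral_visits_eq (s : Finset ι) {Φ : ι → X → X} {Z : ι → Set X}
    (hΦ : ∀ i ∈ s, MeasurePreserving (Φ i) μ μ) (hZ : ∀ i ∈ s, MeasurableSet (Z i)) :
    ∫⁻ x, ∑ i ∈ s, (Z i).indicator (1 : X → ℝ≥0∞) (Φ i x) ∂μ = ∑ i ∈ s, μ (Z i) := by
  rw [lintegral_finsetSum s fun i hi => measurable_indicator_comp (hΦ i hi).measurable (hZ i hi)]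
  refine Finset.sum_congr rfl fun i hi => ?_
  rw [indicator_comp_eq_indicator_preimage, lintegral_indicator_one ((hΦ i hi).measurable (hZ i hi)),
    (hΦ i hi).measure_preimage (hZ i hi).nullMeasurableSet]

/-- **Zone-visit Markov bound**: `n · μ{x : n ≤ ∑_{i∈s} 1_{Z i}(Φ i x)} ≤ ∑_{i∈s} μ(Z i)` for measure-preserving `Φ i`
and measurable `Z i` — the measure of the points visiting the zones at least `n` times is at most the total zone measure
over `n`, with no independence of the visits. [folklore] -/
theorem mul_meas_visits_ge_le (s : Finset ι) {Φ : ι → X → X} {Z : ι → Set X}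
    (hΦ : ∀ i ∈ s, MeasurePreserving (Φ i) μ μ) (hZ : ∀ i ∈ s, MeasurableSet (Z i)) (n : ℝ≥0∞) :
    n * μ {x | n ≤ ∑ i ∈ s, (Z i).indicator (1 : X → ℝ≥0∞) (Φ i x)} ≤ ∑ i ∈ s, μ (Z i) := by
  have hmeas : Measurable fun x => ∑ i ∈ s, (Z i).indicator (1 : X → ℝ≥0∞) (Φ i x) :=
    Finset.measurable_sum s fun i hi => measurable_indicator_comp (hΦ i hi).measurable (hZ i hi)
  calc n * μ {x | n ≤ ∑ i ∈ s, (Z i).indicator (1 : X → ℝ≥0∞) (Φ i x)}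
      ≤ ∫⁻ x, ∑ i ∈ s, (Z i).indicator (1 : X → ℝ≥0∞) (Φ i x) ∂μ :=
        mul_meas_ge_le_lintegral₀ hmeas.aemeasurable n
    _ = ∑ i ∈ s, μ (Z i) := lintegral_visits_eq s hΦ hZ

/-- The zone-visit bound in quotient form: `μ{x : n ≤ #visits} ≤ (∑_{i∈s} μ(Z i)) / n` (`0 < n < ∞`). [folklore] -/
theorem meas_visits_ge_le_div (s : Finset ι) {Φ : ι → X → X} {Z : ι → Set X}
    (hΦ : ∀ i ∈ s, MeasurePreserving (Φ i) μ μ) (hZ : ∀ i ∈ s, MeasurableSet (Z i)) {n : ℝ≥0∞}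
    (hn0 : n ≠ 0) (hn : n ≠ ∞) :
    μ {x | n ≤ ∑ i ∈ s, (Z i).indicator (1 : X → ℝ≥0∞) (Φ i x)} ≤ (∑ i ∈ s, μ (Z i)) / n := by
  rw [ENNReal.le_div_iff_mul_le (Or.inl hn0) (Or.inl hn), mul_comm]
  exact mul_meas_visits_ge_le s hΦ hZ n

end Summit.AnomalousDissipation.AnomalousDissipation.Theorems.SawtoothPulseCascade.K1Zone
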